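/-
Copyright: b2b-lace packet (carver, gen 14).  The two-step recursion of the non-backtracking walk
counts `b_n(x)` on `ℤ^d` (LEMMAS §20 node N68b, x-space half): the coefficient form of
[NoBLE17-I] §1.2.2 `B̂_z(k) = (1 - z²)/(1 + (2d-1)z² - 2dz D̂(k))`.
-/
import Literature.Probability.Percolation.NonBacktrackingPathCounting
import HarnessLib

/-!
# The non-backtracking two-step recursion `b_{n+2} = (2dD) ⋆ b_{n+1} − (2d−1) b_n`

[NoBLE17-I] R. Fitzner, R. van der Hofstad, *Generalized approach to the non-backtracking lace
expansion*, PTRF 169 (2017) 1041–1119, §1.2.2 solves the NBW two-point function in Fourier space: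
"`B̂_z(k) = 1/(1 − 2dz(D̂(k) − z)/(1 − z²)) = (1 − z²)/(1 + (2d−1)z² − 2dz D̂(k))`"
(arXiv:1506.07969 TeX l.904–908; also N. Madras, G. Slade, *The Self-Avoiding Walk* (1993),
Thm 5.3.1 p. 147).  Clearing the denominator, `(1 + (2d−1)z² − 2dz D̂(k)) B̂_z(k) = 1 − z²` says,
coefficient by coefficient in `z` and back in `x`-space (`2d D̂ ↔ Σ_{s ∈ {±e_1,…,±e_d}} δ_s`):

* `b_0 = δ_0` (`card_nbwWordsTo_zero`), `b_1(x) = Σ_s b_0(x − s)` (`card_nbwWordsTo_one`),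
* `b_2(x) + 2d · b_0(x) = Σ_s b_1(x − s)` (`card_nbwWordsTo_two_step_zero`),
* `b_{n+3}(x) + (2d − 1) · b_{n+1}(x) = Σ_s b_{n+2}(x − s)` for every `n ≥ 0`
  (`card_nbwWordsTo_two_step`),

with `b_n(x) = |nbwWordsTo d n x|` the tree's count of non-backtracking step words ending at `x`
(`Percolation/NonBacktrackingPathCounting.lean`).  The combinatorial proof: appending one step `s` to
a non-backtracking word `u` of length `n+1` gives `Σ_s b_{n+1}(x − s)` words ending at `x`
(`card_extWordsTo`); such a word fails to be non-backtracking exactly when `s` reverses the last step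
of `u`, and then it ends where `u` was one step earlier (`card_extWordsTo_filter_not`); the
non-backtracking words of length `n+2` sitting at `x` one step before their end number
`(2d − 1) · b_{n+1}(x)` (`card_nbwWords_filter_wordPos_pred`; `2d · b_0(x)` when `n + 1 = 1`,
`card_nbwWords_one_filter`).  This is the `x`-space half of the b2b-lace input
"`b̂_m(k) = P_m(2d D̂(k))`, `P_0 = 1`, `P_1 = A`, `P_2 = A² − 2d`, `P_m = A P_{m−1} − (2d−1) P_{m−2}`"
(LEMMAS §20 N68b) of the NBW-kernel remainder bound variant; no statement about any dimension is made.

Tools: `wordSnoc` (append a step; inverse to the tree's `wordInit` + last letter),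
`isNBW_wordSnoc_iff`, `wordPos_wordSnoc_of_le`, `wordPos_wordSnoc_succ`, `wordPos_wordInit`.
-/

namespace Literature.Probability.FitznerVanDerHofstad2017

open Literature.Probability.Percolation Literature.Probability.LatticeModels Finset

variable {d : ℕ}

/-! ### Appending a step -/

/-- Append the step `s` to the word `u`. [folklore] -/
def wordSnoc {n : ℕ} (u : Fin n → Fin d × Bool) (s : Fin d × Bool) : Fin (n + 1) → Fin d × Bool :=
  fun i => if h : i.1 < n then u ⟨i.1, h⟩ else s

/-- The appended word agrees with `u` on the first `n` letters. [folklore] -/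
theorem wordSnoc_apply_of_lt {n : ℕ} (u : Fin n → Fin d × Bool) (s : Fin d × Bool)
    {i : Fin (n + 1)} (hi : i.1 < n) : wordSnoc u s i = u ⟨i.1, hi⟩ := dif_pos hi

/-- The last letter of the appended word is `s`. [folklore] -/
theorem wordSnoc_apply_of_not_lt {n : ℕ} (u : Fin n → Fin d × Bool) (s : Fin d × Bool)
    {i : Fin (n + 1)} (hi : ¬ i.1 < n) : wordSnoc u s i = s := dif_neg hi

/-- `wordInit (wordSnoc u s) = u`. [folklore] -/
@[simp] theorem wordInit_wordSnoc {n : ℕ} (u : Fin n → Fin d × Bool) (s : Fin d × Bool) :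
    wordInit (wordSnoc u s) = u := by
  funext i
  show wordSnoc u s ⟨i.1, by omega⟩ = u i
  rw [wordSnoc_apply_of_lt u s (show (⟨i.1, by omega⟩ : Fin (n + 1)).1 < n from i.2)]

/-- The last letter of `wordSnoc u s`. [folklore] -/
@[simp] theorem wordSnoc_last {n : ℕ} (u : Fin n → Fin d × Bool) (s : Fin d × Bool) {h : n < n + 1} :
    wordSnoc u s ⟨n, h⟩ = s :=
  wordSnoc_apply_of_not_lt u s (by simp)

/-- A word is its prefix with its last letter appended. [folklore] -/
theorem wordSnoc_wordInit {n : ℕ} (w : Fin (n + 1) → Fin d × Bool) :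
    wordSnoc (wordInit w) (w ⟨n, lt_add_one n⟩) = w := by
  funext i
  by_cases hi : i.1 < n
  · rw [wordSnoc_apply_of_lt _ _ hi]
    rfl
  · rw [wordSnoc_apply_of_not_lt _ _ hi]
    have h2 := i.2
    congr 1
    exact Fin.ext (by simp; omega)

/-- The first `k ≤ n` positions of `wordSnoc u s` are those of `u`. [folklore] -/
theorem wordPos_wordSnoc_of_le {n : ℕ} (u : Fin n → Fin d × Bool) (s : Fin d × Bool) {k : ℕ}
    (hk : k ≤ n) : wordPos (wordSnoc u s) k = wordPos u k := by
  unfold wordPos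
  refine Finset.sum_congr rfl fun i hi => ?_
  have hin : i < n := lt_of_lt_of_le (Finset.mem_range.1 hi) hk
  rw [dif_pos (show i < n + 1 by omega), dif_pos hin, wordSnoc_apply_of_lt u s (show (⟨i, _⟩ : Fin (n + 1)).1 < n from hin)]

/-- The end point of `wordSnoc u s` is the end point of `u` plus the step `s`. [folklore] -/
theorem wordPos_wordSnoc_succ {n : ℕ} (u : Fin n → Fin d × Bool) (s : Fin d × Bool) :
    wordPos (wordSnoc u s) (n + 1) = wordPos u n + stepVec s := by
  rw [wordPos_succ _ (lt_add_one n), wordPos_wordSnoc_of_le u s le_rfl, wordSnoc_last]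

/-- The first `k ≤ n` positions of a word of length `n + 1` are those of its prefix. [folklore] -/
theorem wordPos_wordInit {n : ℕ} (w : Fin (n + 1) → Fin d × Bool) {k : ℕ} (hk : k ≤ n) :
    wordPos (wordInit w) k = wordPos w k := by
  conv_rhs => rw [← wordSnoc_wordInit w]
  exact (wordPos_wordSnoc_of_le _ _ hk).symm

/-- **Appending a step keeps non-backtracking iff the step does not reverse the last one**:
`wordSnoc u s` is non-backtracking iff `u` is and (when `u` is non-empty) `s ≠ rev u_{n-1}`.
[cite: MadrasSlade1993, §1.2 (memory τ = 2 rules out immediate reversals)] -/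
theorem isNBW_wordSnoc_iff {n : ℕ} (u : Fin n → Fin d × Bool) (s : Fin d × Bool) :
    IsNBW (wordSnoc u s) ↔ IsNBW u ∧ ∀ h : 1 ≤ n, s ≠ srev (u ⟨n - 1, by omega⟩) := by
  constructor
  · intro hw
    refine ⟨fun k hk => ?_, fun h1 => ?_⟩
    · have := hw k (by omega)
      rwa [wordSnoc_apply_of_lt u s (show (⟨k + 1, _⟩ : Fin (n + 1)).1 < n from hk),
        wordSnoc_apply_of_lt u s (show (⟨k, _⟩ : Fin (n + 1)).1 < n by simp; omega)] at this
    · have := hw (n - 1) (by omega)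
      rwa [wordSnoc_apply_of_not_lt u s (show ¬ (⟨n - 1 + 1, _⟩ : Fin (n + 1)).1 < n by simp; omega),
        wordSnoc_apply_of_lt u s (show (⟨n - 1, _⟩ : Fin (n + 1)).1 < n by simp; omega)] at this
  · rintro ⟨hu, hs⟩ k hk
    by_cases hkn : k + 1 < n
    · rw [wordSnoc_apply_of_lt u s (show (⟨k + 1, hk⟩ : Fin (n + 1)).1 < n from hkn),
        wordSnoc_apply_of_lt u s (show (⟨k, _⟩ : Fin (n + 1)).1 < n by simp; omega)]
      exact hu k hkn
    · obtain rfl : k = n - 1 := by omega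
      rw [wordSnoc_apply_of_not_lt u s (show ¬ (⟨n - 1 + 1, hk⟩ : Fin (n + 1)).1 < n from hkn),
        wordSnoc_apply_of_lt u s (show (⟨n - 1, _⟩ : Fin (n + 1)).1 < n by simp; omega)]
      exact hs (by omega)

/-- In a word of length `m + 2` whose prefix is non-backtracking but which is not, the last step
reverses the one before. [cite: MadrasSlade1993, §1.2 (memory τ = 2)] -/
theorem last_eq_srev_of_not_isNBW {m : ℕ} (w : Fin (m + 2) → Fin d × Bool)
    (hi : IsNBW (wordInit w)) (hn : ¬ IsNBW w) :
    w ⟨m + 1, by omega⟩ = srev (w ⟨m, by omega⟩) := by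
  by_contra hne
  apply hn
  have aux : w ⟨m + 1, by omega⟩ ≠ srev ((wordInit w) ⟨m + 1 - 1, by omega⟩) :=
    fun h => hne (h.trans rfl)
  have key := (isNBW_wordSnoc_iff (wordInit w) (w ⟨m + 1, by omega⟩)).2 ⟨hi, fun _ => aux⟩
  rwa [wordSnoc_wordInit] at key

/-! ### The three counts -/

open Classical in
/-- The words of length `n + 1` whose first `n` steps are non-backtracking and which end at `x`
(all one-step extensions of non-backtracking words, sorted by end point). [folklore] -/
noncomputable def extWordsTo (d n : ℕ) (x : Site d) : Finset (Fin (n + 1) → Fin d × Bool) :=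
  Finset.univ.filter fun w => IsNBW (wordInit w) ∧ wordPos w (n + 1) = x

/-- Membership in `extWordsTo`. [folklore] -/
@[simp] theorem mem_extWordsTo {n : ℕ} {x : Site d} {w : Fin (n + 1) → Fin d × Bool} :
    w ∈ extWordsTo d n x ↔ IsNBW (wordInit w) ∧ wordPos w (n + 1) = x := by
  simp [extWordsTo]

/-- Membership in `nbwWordsTo`. [folklore] -/
theorem mem_nbwWordsTo {n : ℕ} {x : Site d} {w : Fin n → Fin d × Bool} :
    w ∈ nbwWordsTo d n x ↔ IsNBW w ∧ wordPos w n = x := by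
  rw [nbwWordsTo, Finset.mem_filter, mem_nbwWords]

/-- **Extension count**: `|extWordsTo d n x| = Σ_s b_n(x − s)` — a one-step extension ending at `x`
is a non-backtracking word ending at `x − s` followed by the step `s`. [folklore] -/
theorem card_extWordsTo (n : ℕ) (x : Site d) :
    (extWordsTo d n x).card = ∑ s : Fin d × Bool, (nbwWordsTo d n (x - stepVec s)).card := by
  rw [← Finset.card_sigma]
  symm
  refine Finset.card_nbij' (fun p => wordSnoc p.2 p.1) (fun w => ⟨w ⟨n, lt_add_one n⟩, wordInit w⟩)
    ?_ ?_ ?_ ?_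
  · rintro ⟨s, u⟩ hp
    simp only [Finset.mem_coe, Finset.mem_sigma, Finset.mem_univ, true_and, mem_nbwWordsTo] at hp
    obtain ⟨hu, hx⟩ := hp
    simp only [Finset.mem_coe, mem_extWordsTo, wordInit_wordSnoc, wordPos_wordSnoc_succ]
    exact ⟨hu, by rw [hx, sub_add_cancel]⟩
  · intro w hw
    simp only [Finset.mem_coe, mem_extWordsTo] at hw
    simp only [Finset.mem_coe, Finset.mem_sigma, Finset.mem_univ, true_and, mem_nbwWordsTo]
    refine ⟨hw.1, ?_⟩
    have h := wordPos_succ w (lt_add_one n)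
    rw [hw.2] at h
    rw [wordPos_wordInit w le_rfl, eq_sub_iff_add_eq]
    exact h.symm
  · rintro ⟨s, u⟩ _
    simp
  · intro w _
    exact wordSnoc_wordInit w

open Classical in
/-- **Split by the non-backtracking property**: `|extWordsTo d n x| = b_{n+1}(x) + #(backtracking
extensions ending at x)`. [folklore] -/
theorem card_extWordsTo_eq_add (n : ℕ) (x : Site d) :
    (extWordsTo d n x).card =
      (nbwWordsTo d (n + 1) x).card + ((extWordsTo d n x).filter fun w => ¬ IsNBW w).card := by
  rw [← Finset.card_filter_add_card_filter_not (s := extWordsTo d n x) (fun w => IsNBW w)]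
  congr 2
  ext w
  simp only [Finset.mem_filter, mem_extWordsTo, mem_nbwWordsTo]
  constructor
  · rintro ⟨⟨-, hx⟩, hw⟩
    exact ⟨hw, hx⟩
  · rintro ⟨hw, hx⟩
    exact ⟨⟨hw.wordInit, hx⟩, hw⟩

open Classical in
/-- **Backtracking extensions**: the extensions of length `m + 2` ending at `x` that DO backtrack are
in bijection (drop the last step) with the non-backtracking words of length `m + 1` whose position
one step before the end is `x`. [cite: MadrasSlade1993, §1.2 (memory τ = 2)] -/
theorem card_extWordsTo_filter_not (m : ℕ) (x : Site d) :
    ((extWordsTo d (m + 1) x).filter fun w => ¬ IsNBW w).card =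
      ((nbwWords d (m + 1)).filter fun u => wordPos u m = x).card := by
  refine Finset.card_nbij' (fun w => wordInit w) (fun u => wordSnoc u (srev (u ⟨m, by omega⟩)))
    ?_ ?_ ?_ ?_
  · intro w hw
    simp only [Finset.mem_coe, Finset.mem_filter, mem_extWordsTo] at hw
    obtain ⟨⟨hi, hx⟩, hn⟩ := hw
    simp only [Finset.mem_coe, Finset.mem_filter, mem_nbwWords]
    refine ⟨hi, ?_⟩
    have hrev := last_eq_srev_of_not_isNBW w hi hn
    have h2 := wordPos_add_two_of_srev w (k := m) (by omega) hrev
    rw [wordPos_wordInit w (by omega : m ≤ m + 1), ← h2, hx]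
  · intro u hu
    simp only [Finset.mem_coe, Finset.mem_filter, mem_nbwWords] at hu
    simp only [Finset.mem_coe, Finset.mem_filter, mem_extWordsTo, wordInit_wordSnoc]
    refine ⟨⟨hu.1, ?_⟩, ?_⟩
    · rw [wordPos_wordSnoc_succ, wordPos_succ u (by omega : m < m + 1), stepVec_srev, hu.2]
      abel
    · rw [isNBW_wordSnoc_iff]
      rintro ⟨-, h⟩
      exact h (by omega) (congrArg (fun i => srev (u i)) (Fin.ext (by simp)))
  · intro w hw
    simp only [Finset.mem_coe, Finset.mem_filter, mem_extWordsTo] at hw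
    have hrev := last_eq_srev_of_not_isNBW w hw.1.1 hw.2
    have e : srev ((wordInit w) ⟨m, by omega⟩) = w ⟨m + 1, lt_add_one (m + 1)⟩ := hrev.symm
    show wordSnoc (wordInit w) (srev ((wordInit w) ⟨m, by omega⟩)) = w
    rw [e]
    exact wordSnoc_wordInit w
  · intro u _
    exact wordInit_wordSnoc u _

/-- The number of free directions after a step: `|{± e_1, …, ± e_d} ∖ {a}| = 2d − 1`. [folklore] -/
theorem card_univ_erase_step (a : Fin d × Bool) :
    (Finset.univ.erase a).card = 2 * d - 1 := by
  rw [Finset.card_erase_of_mem (Finset.mem_univ _), Finset.card_univ, Fintype.card_prod,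
    Fintype.card_fin, Fintype.card_bool, mul_comm]

/-- **Position one step before the end**: the non-backtracking words of length `k + 2` sitting at
`x` after `k + 1` steps number `(2d − 1) · b_{k+1}(x)` ("each new step has `2d − 1` choices").
[cite: MadrasSlade1993, §1.2 (c_{N,2} = 2d(2d-1)^{N-1})] -/
theorem card_nbwWords_filter_wordPos_pred (k : ℕ) (x : Site d) :
    ((nbwWords d (k + 2)).filter fun u => wordPos u (k + 1) = x).card =
      (2 * d - 1) * (nbwWordsTo d (k + 1) x).card := by
  classical
  rw [mul_comm, ← smul_eq_mul, ← Finset.sum_const]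
  rw [show ∑ _v ∈ nbwWordsTo d (k + 1) x, (2 * d - 1) =
      ∑ v ∈ nbwWordsTo d (k + 1) x, (Finset.univ.erase (srev (v ⟨k, by omega⟩))).card from
    Finset.sum_congr rfl fun v _ => (card_univ_erase_step _).symm, ← Finset.card_sigma]
  refine Finset.card_nbij'
    (fun u => (⟨wordInit u, u ⟨k + 1, by omega⟩⟩ : Σ _ : Fin (k + 1) → Fin d × Bool, Fin d × Bool))
    (fun p => wordSnoc p.1 p.2) ?_ ?_ ?_ ?_
  · intro u hu
    simp only [Finset.mem_coe, Finset.mem_filter, mem_nbwWords] at hu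
    have h := (isNBW_wordSnoc_iff (wordInit u) (u ⟨k + 1, by omega⟩)).1
      (by rw [wordSnoc_wordInit]; exact hu.1)
    simp only [Finset.mem_coe, Finset.mem_sigma, Finset.mem_erase, Finset.mem_univ, and_true,
      mem_nbwWordsTo]
    refine ⟨⟨h.1, by rw [wordPos_wordInit u le_rfl]; exact hu.2⟩, ?_⟩
    intro habs
    exact h.2 (by omega) (habs.trans (congrArg (fun i => srev (wordInit u i)) (Fin.ext (by simp))))
  · rintro ⟨v, t⟩ hp
    simp only [Finset.mem_coe, Finset.mem_sigma, Finset.mem_erase, Finset.mem_univ, and_true,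
      mem_nbwWordsTo] at hp
    obtain ⟨⟨hv, hx⟩, ht⟩ := hp
    simp only [Finset.mem_coe, Finset.mem_filter, mem_nbwWords]
    refine ⟨(isNBW_wordSnoc_iff v t).2 ⟨hv, fun _ => ?_⟩, ?_⟩
    · intro habs
      exact ht (habs.trans (congrArg (fun i => srev (v i)) (Fin.ext (by simp))))
    · rw [wordPos_wordSnoc_of_le v t le_rfl]
      exact hx
  · intro u _
    exact wordSnoc_wordInit u
  · rintro ⟨v, t⟩ _
    simp

/-- **One-letter words**: all `2d` words of length `1` are non-backtracking, and they sit at the origin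
before their step. [folklore] -/
theorem card_nbwWords_one_filter (x : Site d) :
    ((nbwWords d 1).filter fun u => wordPos u 0 = x).card = if x = 0 then 2 * d else 0 := by
  classical
  have hall : nbwWords d 1 = Finset.univ := by
    ext u
    simp only [mem_nbwWords, Finset.mem_univ, iff_true]
    intro k hk
    omega
  simp only [wordPos_zero, hall]
  split_ifs with hx
  · subst hx
    rw [Finset.filter_true_of_mem fun _ _ => rfl, Finset.card_univ, Fintype.card_fun,
      Fintype.card_prod, Fintype.card_fin, Fintype.card_fin, Fintype.card_bool, pow_one, mul_comm]
  · rw [Finset.filter_false_of_mem fun _ _ h => hx h.symm, Finset.card_empty]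

/-! ### The recursion -/

/-- **`b_0 = δ_0`**: the empty word is the only word of length `0`, and it ends at the origin.
[cite: FitznerVanDerHofstad2016NoBLE, §1.2.2 (B̂_z(k) = (1-z²)/(1+(2d-1)z²-2dzD̂(k)), coefficient of z⁰; arXiv:1506.07969 TeX l.904–908)] -/
theorem card_nbwWordsTo_zero (x : Site d) : (nbwWordsTo d 0 x).card = if x = 0 then 1 else 0 := by
  classical
  have hall : nbwWords d 0 = Finset.univ := by
    ext u
    simp only [mem_nbwWords, Finset.mem_univ, iff_true]
    intro k hk
    omega
  rw [nbwWordsTo, hall]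
  simp only [wordPos_zero]
  split_ifs with hx
  · subst hx
    rw [Finset.filter_true_of_mem fun _ _ => rfl, Finset.card_univ, Fintype.card_fun,
      Fintype.card_fin, pow_zero]
  · rw [Finset.filter_false_of_mem fun _ _ h => hx h.symm, Finset.card_empty]

/-- **`b_1(x) = Σ_s b_0(x − s)`** (`b̂_1 = 2d D̂`): every one-step word is non-backtracking.
[cite: FitznerVanDerHofstad2016NoBLE, §1.2.2 (B̂_z(k) = (1-z²)/(1+(2d-1)z²-2dzD̂(k)), coefficient of z¹; arXiv:1506.07969 TeX l.904–908)] -/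
theorem card_nbwWordsTo_one (x : Site d) :
    (nbwWordsTo d 1 x).card = ∑ s : Fin d × Bool, (nbwWordsTo d 0 (x - stepVec s)).card := by
  classical
  have hzero : ((extWordsTo d 0 x).filter fun w => ¬ IsNBW w).card = 0 := by
    rw [Finset.card_eq_zero, Finset.filter_eq_empty_iff]
    intro w _ h
    exact h fun k hk => by omega
  have h := card_extWordsTo_eq_add (d := d) 0 x
  rw [card_extWordsTo 0 x, hzero, add_zero] at h
  exact h.symm

/-- **`b_2(x) + 2d · b_0(x) = Σ_s b_1(x − s)`** (`b̂_2 = (2dD̂)² − 2d`): of the `Σ_s b_1(x − s)`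
two-step extensions ending at `x`, exactly the `2d` immediate returns (at `x = 0`) backtrack.
[cite: FitznerVanDerHofstad2016NoBLE, §1.2.2 (B̂_z(k) = (1-z²)/(1+(2d-1)z²-2dzD̂(k)), coefficient of z²; arXiv:1506.07969 TeX l.904–908)] -/
theorem card_nbwWordsTo_two_step_zero (x : Site d) :
    (nbwWordsTo d 2 x).card + 2 * d * (nbwWordsTo d 0 x).card =
      ∑ s : Fin d × Bool, (nbwWordsTo d 1 (x - stepVec s)).card := by
  classical
  have h := card_extWordsTo_eq_add (d := d) 1 x
  rw [card_extWordsTo 1 x, card_extWordsTo_filter_not 0 x, card_nbwWords_one_filter x] at h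
  rw [h, card_nbwWordsTo_zero x]
  split_ifs <;> simp

/-- **The two-step recursion `b_{n+3}(x) + (2d − 1) · b_{n+1}(x) = Σ_s b_{n+2}(x − s)`** for every
`n ≥ 0` (`b̂_{m} = 2dD̂ · b̂_{m−1} − (2d−1) b̂_{m−2}`, `m ≥ 3`): of the `Σ_s b_{n+2}(x − s)` one-step
extensions ending at `x`, the backtracking ones are the non-backtracking words of length `n + 2`
passing through `x` one step before their end, `(2d − 1) · b_{n+1}(x)` of them.
[cite: FitznerVanDerHofstad2016NoBLE, §1.2.2 (B̂_z(k) = (1-z²)/(1+(2d-1)z²-2dzD̂(k)), coefficient of z^{n+3}; arXiv:1506.07969 TeX l.904–908)]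
[cite: MadrasSlade1993, Thm 5.3.1 p. 147] -/
theorem card_nbwWordsTo_two_step (n : ℕ) (x : Site d) :
    (nbwWordsTo d (n + 3) x).card + (2 * d - 1) * (nbwWordsTo d (n + 1) x).card =
      ∑ s : Fin d × Bool, (nbwWordsTo d (n + 2) (x - stepVec s)).card := by
  classical
  have h := card_extWordsTo_eq_add (d := d) (n + 2) x
  rw [card_extWordsTo (n + 2) x, card_extWordsTo_filter_not (n + 1) x,
    card_nbwWords_filter_wordPos_pred n x] at h
  exact h.symm

end Literature.Probability.FitznerVanDerHofstad2017
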